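import Summits.BirchSwinnertonDyer.BirchSwinnertonDyer.Theorems.AlignedTransportAtTwoMainConjectureOfRankZeroBSDAtTwoCubicLayerOneDoors
import Summits.BirchSwinnertonDyer.BirchSwinnertonDyer.Theorems.ByReductionTypeAtTwoTowerClass1727a
import HarnessLib

/-!
# Route `AlignedTransportAtTwo`, crux C2 `MainConjectureOfRankZeroBSDAtTwo` (stmt-BirchSwinnertonDyer-22298):
# THE ROW AT THE SEED `1727a1` in the THIRD certificate currency — `MC₂(1727a1)` modulo PRINT⁵ + MuIneqʳ + the seed's analytic data +
# TWO displayed bits about the cubic field `ℚ(e₁)` of discriminant `−1727`: «three primes above `2`» and «`rank₂ Cl` equal at layers `1, 2`»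

HONEST FRAMING (cell `bsd-f1-sign2`, WIDTH-5 attached prover seat `bsd-line-att-p5` gen 25; `--supports` stmt-BirchSwinnertonDyer-22298, closes
nothing; BSD is NOT proved by any of this; the crux and its verdict are untouched). THEOREMS ONLY. For `1727a1` Mazur's `2`-adic main conjecture
is ALREADY kernel modulo PRINT + `hS34` + one `2^∞`-Selmer count in the third cyclotomic layer (C2′, `mazurMainConjecture_two_1727a1_certified₀`,
cell files `…CertifiedSeeds*`); this file is the INDEPENDENT class-group road of att-p2 g2's «third currency» (D-att-p2-1), through this seat's
layer-`(1,2)` rank door (`…CubicLayerOneDoors`), the layer-`(0,1)` doors being provably void here (`Δ = −1727 ≡ 1 (mod 8)`, `2` totally split).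

THE TWO DISPLAYED NUMBER-FIELD BITS and their numerical status (NOT kernel; PARI via kit, cell bsd-2adic, GRH as in those jobs): the cubic field
`K = ℚ(e₁)` of `1727a1` has discriminant `−1727 = −11·157` (fundamental; `2` unramified, index `16` in `disc(X³ − 3X² − 1216X + 17600) = −2⁸·1727`),
and there is exactly ONE cubic field of that discriminant (`Cl(ℚ(√−1727)) ≅ ℤ/36` is cyclic, `3`-rank `1` — reduced forms, seat script), so it is
the point field `ℚ(P)` of bsd-2adic's census row `151976q1` (`d3 = −1727`): kit j289938 / j300990 report `dec2 = e1f1,e1f1,e1f1` (three primes —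
bit `h3p`), `Cl(K) = 1`, `Cl(K(√2)) = [2, 2]`, `Cl(K·ℚ(ζ₁₆)⁺) = [4, 2]` (verdict `FUKUDA2-R`): `rank₂` is `0, 2, 2` along the layers `0, 1, 2`, so
the RANK equality holds at `n = 1` (bit `hrank`) while `e = 0, 2, 3` jumps (as `…CubicLayerOneParity` predicts at the first step). Nothing of this
is asserted by the theorem below: both bits are hypotheses.

* `Δ_neg_1727a1` (`Δ = −1727 < 0`, kernel) and **`mazurMainConjecture_two_1727a1_of_cubicRankLayers`** — the row.

References: [Fukuda1994] Thm. 1 (2), p. 264; [Kato2004Asterisque] Thm. 17.4 (1)(2); [GreenbergLNM1716] Conj. 1.11, Thm. 4.1; [CremonaAlgorithms1997]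
Table 1 (`1727a1`); [Hasse1930] / [Cohen1993] §5 (cubic fields of given discriminant ↔ index-`3` subgroups of `Cl(ℚ(√D))`); tree p742953, p739408.
-/

set_option linter.dupNamespace false
set_option autoImplicit false

noncomputable section

open scoped Classical NumberField

namespace Summit.BirchSwinnertonDyer.BirchSwinnertonDyer.Theorems.AlignedTransportAtTwoCubicLayerOneDoors

open NumberField IsDedekindDomain CongruenceSubgroup WeierstrassCurve Polynomial IntermediateField
  Literature.NumberTheory.GaloisRepresentations Literature.NumberTheory.IwasawaTheory
  Literature.NumberTheory.EllipticCurves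
  Literature.NumberTheory.EllipticCurves.ModularForms
  Literature.NumberTheory.EllipticCurves.Rank1Residual
  Literature.NumberTheory.EllipticCurves.Greenberg1999
  Literature.NumberTheory.EllipticCurves.Module
  Summit.BirchSwinnertonDyer.Rank1Residual
  Summit.BirchSwinnertonDyer.Rank1Residual.X1.MuLambda
  Summit.BirchSwinnertonDyer.Rank1Residual.X5
  Summit.BirchSwinnertonDyer.Rank1Residual.F1Sign2
  Summit.BirchSwinnertonDyer.BirchSwinnertonDyer.Theorems.Rank1ResidualX1Defs
  Summit.BirchSwinnertonDyer.BirchSwinnertonDyer.Theses.AlignedTransportAtTwo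
  Summit.BirchSwinnertonDyer.BirchSwinnertonDyer.Theorems.TowerClass

/-- `Δ(1727a1) = −1727 < 0` on Cremona's model over `ℚ`. [cite: CremonaAlgorithms1997, Table 1] -/
theorem Δ_neg_1727a1 : c1727a1.Δ < 0 := by
  rw [baseChange_int_Δ, M1727a1_Δ]; norm_num

/-- **THE ROW AT `1727a1`, class-group currency.** Granted PRINT⁵ {Kato 17.4 (1)(2) at `2` for `1727a1` (`h17`), Greenberg 4.1 (`hGr`), period
unit (`hper`), modularity (`hmod`), GZK (`hGZK`)}, the registered stub MuIneqʳ verbatim (`hI`), the seed's analytic data (`r_an = 0`, analytic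
`μ₂ = 0` on the even branch, `BSD₂(1727a1)` — the crux's own hypotheses at this `W`), a root `β` of the `2`-division cubic of `1727a1`, and the two
displayed bits «three primes above `2` in `ℚ(β)`» (`h3p`) and «`rank₂ Cl(ℚ(β)·ℚ(ζ₁₆)⁺) = rank₂ Cl(ℚ(β)(√2))` for every cyclotomic `ℤ₂`-extension of
`ℚ(β)`» (`hrank`; numerically `2 = 2`, bsd-2adic kit j300990): Mazur's `2`-adic main conjecture for `1727a1`. Good ordinary reduction at `2`, no
rational `2`-torsion abscissa and `Δ < 0` are KERNEL facts (`Theorems/ByReductionTypeAtTwoTowerClass1727a.lean`, `Δ_neg_1727a1`).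
[cite: Fukuda1994, Thm. 1 (2), p. 264] [cite: Kato2004Asterisque, Thm. 17.4 (1)(2) (p. 273)] [cite: GreenbergLNM1716, Thm. 4.1 (p. 102) and Conj. 1.11 (p. 58)] -/
theorem mazurMainConjecture_two_1727a1_of_cubicRankLayers
    (h17 : ∀ [NeZero (c1727a1.conductorNorm ℤ)] (f : CuspForm (Gamma0 (c1727a1.conductorNorm ℤ)) 2),
      kato_divisibility_allPrimes c1727a1 2 (f := f))
    (hGr : Greenberg1999.thm41_charValue_rankZero_anyPrime)
    (hper : realPeriodRat_eq_unit_mul_plusPeriod_two) (hmod : nonempty_modularParametrizationData)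
    (hGZK : rank_eq_analyticRank_of_analyticRank_le_one)
    (hI : ∀ (W : WeierstrassCurve ℚ) [W.IsElliptic] [W.IsGloballyMinimal], IsOrdinaryAt W 2 →
      (∀ x : ℚ, ¬ HasRationalTwoTorsionX W x) →
      ∀ (κ : ZpExtension ℚ 2) (γ : Field.absoluteGaloisGroup ℚ), κ.IsCyclotomic →
      κ.IsTopGenerator γ → IsCyclotomicVariable 2 γ →
      ∀ ⦃N : ℕ⦄ [NeZero N] (f : CuspForm (Gamma0 N) 2), IsNewformOf W f →
      ∀ Gp : IwasawaAlgebra 2, iwasawaToPowerSeries 2 Gp = padicLFunction f (unitRoot W 2 : ℚ_[2]) →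
      ∀ (D : W.SelmerDualData κ γ) (Yr : W.FineSelmerDualDataRelaxedInf κ γ),
        lengthAt (IwasawaAlgebra 2) D.X ⟨IwasawaAlgebra.augIdealP 2, IwasawaAlgebra.isPrime_augIdealP_holds 2⟩ ≤
          lengthAt (IwasawaAlgebra 2) (IwasawaAlgebra 2 ⧸ Ideal.span {Gp})
              ⟨IwasawaAlgebra.augIdealP 2, IwasawaAlgebra.isPrime_augIdealP_holds 2⟩ +
            lengthAt (IwasawaAlgebra 2) Yr.X ⟨IwasawaAlgebra.augIdealP 2, IwasawaAlgebra.isPrime_augIdealP_holds 2⟩)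
    (hr0 : c1727a1.analyticRank = 0)
    (hμan : ∀ ⦃N : ℕ⦄ [NeZero N] (f : CuspForm (Gamma0 N) 2), IsNewformOf c1727a1 f →
      ∀ G : IwasawaAlgebra 2, IsEvenBranchLiftAtTwo c1727a1 f G → red G ≠ 0)
    (hbsd : BSDp c1727a1 2)
    {β : AlgebraicClosure ℚ} (hβ : aeval β c1727a1.twoTorsionPolynomial.toPoly = 0)
    (h3p : 3 ≤ {v : HeightOneSpectrum (𝓞 ↥(IntermediateField.adjoin ℚ ({β} : Set (AlgebraicClosure ℚ)))) |
      ((2 : ℕ) : 𝓞 ↥(IntermediateField.adjoin ℚ ({β} : Set (AlgebraicClosure ℚ)))) ∈ v.asIdeal}.ncard)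
    (hrank : ∀ κP : ZpExtension ↥(IntermediateField.adjoin ℚ ({β} : Set (AlgebraicClosure ℚ))) 2, κP.IsCyclotomic →
      classGroupPRank κP 2 = classGroupPRank κP 1) :
    MazurMainConjecture c1727a1 2 :=
  mazurMainConjecture_two_of_muIneqRel_of_threePrimes_of_classGroupPRank_succ_eq c1727a1 h17 hGr hper hmod hGZK hI
    goodOrd_two_1727a1 not_hasRationalTwoTorsionX_1727a1 Δ_neg_1727a1 hr0 hμan hbsd hβ h3p fun κP hκP => ⟨1, hrank κP hκP⟩

end Summit.BirchSwinnertonDyer.BirchSwinnertonDyer.Theorems.AlignedTransportAtTwoCubicLayerOneDoors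

end
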